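import Summits.QuantumFields.YangMills.Theses.ThermodynamicCeilings
import Summits.QuantumFields.YangMills.Theorems.AntiScreeningCeilingsAbelTransfer

/-!
# Route `ThermodynamicCeilings` — the edge `SubhomogeneousSpectralMeasureR → WindowedSpectralMeasure` (LINE F is a WEAKENING)

D-0145 ideator seat ym-idea-11 (generation g5, lens «wuc»).  The crux `WindowedSpectralMeasure` (stmt-QuantumFields-27776) of route
`ThermodynamicCeilings` is implied by the crux `SubhomogeneousSpectralMeasureR` (stmt-QuantumFields-27501) of route
`AntiScreeningCeilings`: the two statements agree up to the doubling clause; 27501 asks the degree-8 doubling bound for all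
`x ≥ E₀ := max (s/ℓ) (4/L)` and all `λ ≥ 1`, 27776 only on the window `λx ≤ 1` plus the Laplace-weighted UV bound
`∫_{E≥1} e^{-2E} dν ≤ A ν([0,1))` (guarded by `E₀ ≤ 1`).  The UV bound follows from unrestricted doubling by the layer-cake formula
`∫ e^{-2E} dν = ∫₀^∞ ν([0,-log s/2)) ds` (landed `Spectral.laplace_layer_cake`), doubling from `x = 1` with `λ = max(1, -log s/2)`,
`λ⁸ ≤ (1+8⁸) e^{-log s/2} = (1+8⁸) s^{-1/2}` and `∫₀¹ s^{-1/2} ds = 2`; constant `A ↦ 2A(1+8⁸)`.  So any proof of 27501 closes 27776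
a fortiori (and 27776 + `AbelWindowTransferW` close K_M).  Mathlib + the landed Abel-transfer lemmas only; an implication between two
OPEN cruxes — nothing is closed, no summit / leaf / NT / UV-stability / IR statement is proved.
-/

namespace Summit.QuantumFields.YangMills.Cruxes.ScaleMonotonicity.SpectralEdge

open MeasureTheory Set
open Summit.QuantumFields.YangMills.Cruxes.ScaleMonotonicity.Spectral (laplace_layer_cake cum_zero doubling_ennreal exp_integrable)

/-- `t⁸ ≤ 8⁸ eᵗ` for `t ≥ 0`. -/
theorem pow_eight_le_exp (t : ℝ) (ht : 0 ≤ t) : t ^ 8 ≤ 8 ^ 8 * Real.exp t := by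
  have h1 : t / 8 ≤ Real.exp (t / 8) := by linarith [Real.add_one_le_exp (t / 8)]
  have h2 : t ≤ 8 * Real.exp (t / 8) := by linarith
  have h3 : t ^ 8 ≤ (8 * Real.exp (t / 8)) ^ 8 := pow_le_pow_left₀ ht h2 8
  have h4 : (8 * Real.exp (t / 8)) ^ 8 = 8 ^ 8 * Real.exp t := by
    rw [mul_pow, ← Real.exp_nat_mul]; congr 1; congr 1; push_cast; ring
  exact h3.trans_eq h4

/-- `∫₀¹ e^{-log s/2} ds = ∫₀¹ s^{-1/2} ds = 2`, in `ℝ≥0∞` form. -/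
theorem lintegral_exp_neg_log_half :
    ∫⁻ s in Ioo (0:ℝ) 1, ENNReal.ofReal (Real.exp (-Real.log s / 2)) = ENNReal.ofReal 2 := by
  have heq : ∀ s ∈ Ioo (0:ℝ) 1, Real.exp (-Real.log s / 2) = s ^ (-(1 / 2 : ℝ)) := fun s hs => by
    rw [Real.rpow_def_of_pos hs.1]; congr 1; ring
  have hII : IntervalIntegrable (fun s : ℝ => s ^ (-(1 / 2 : ℝ))) volume 0 1 :=
    intervalIntegral.intervalIntegrable_rpow' (by norm_num)
  have hIoc : IntegrableOn (fun s : ℝ => s ^ (-(1 / 2 : ℝ))) (Ioc 0 1) volume :=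
    (intervalIntegrable_iff_integrableOn_Ioc_of_le zero_le_one).1 hII
  have hI : IntegrableOn (fun s : ℝ => s ^ (-(1 / 2 : ℝ))) (Ioo 0 1) volume := hIoc.mono_set Ioo_subset_Ioc_self
  have hval : ∫ s in Ioo (0:ℝ) 1, s ^ (-(1 / 2 : ℝ)) = 2 := by
    rw [← integral_Ioc_eq_integral_Ioo, ← intervalIntegral.integral_of_le zero_le_one,
      integral_rpow (Or.inl (by norm_num))]
    rw [Real.zero_rpow (by norm_num), Real.one_rpow]
    norm_num
  calc ∫⁻ s in Ioo (0:ℝ) 1, ENNReal.ofReal (Real.exp (-Real.log s / 2))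
      = ∫⁻ s in Ioo (0:ℝ) 1, ENNReal.ofReal (s ^ (-(1 / 2 : ℝ))) :=
        setLIntegral_congr_fun measurableSet_Ioo (fun s hs => by rw [heq s hs])
    _ = ENNReal.ofReal (∫ s in Ioo (0:ℝ) 1, s ^ (-(1 / 2 : ℝ))) := by
        rw [ofReal_integral_eq_lintegral_ofReal hI]
        filter_upwards [ae_restrict_mem measurableSet_Ioo] with s hs
        exact Real.rpow_nonneg hs.1.le _
    _ = ENNReal.ofReal 2 := by rw [hval]

/-- FULL doubling above `E₀ ≤ 1` ⇒ the Laplace-weighted UV bound `∫_{E≥1} e^{-2E} dν ≤ 2A(1+8⁸)·ν([0,1))`. -/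
theorem uv_of_doubling (ν : Measure ℝ) [IsFiniteMeasure ν] (hsupp : ν (Iic 0) = 0) (A E₀ : ℝ) (hA : 1 ≤ A)
    (hE₀1 : E₀ ≤ 1)
    (hdbl : ∀ lam x : ℝ, 1 ≤ lam → E₀ ≤ x → (ν (Iio (lam * x))).toReal ≤ A * lam ^ 8 * (ν (Iio x)).toReal) :
    (∫ E in Ici (1:ℝ), Real.exp (-(2 * E)) ∂ν) ≤ 2 * A * (1 + 8 ^ 8) * (ν (Iio 1)).toReal := by
  have hA0 : 0 ≤ A := by linarith
  have hd := doubling_ennreal ν A E₀ hA hdbl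
  have hf2 : (fun E : ℝ => Real.exp (-(2 * E))) = fun E => Real.exp (-(E * 2)) := by
    funext E; ring_nf
  have hI : Integrable (fun E : ℝ => Real.exp (-(E * 2))) ν := exp_integrable ν hsupp 2 (by norm_num)
  have h1 : (∫ E in Ici (1:ℝ), Real.exp (-(2 * E)) ∂ν) ≤ ∫ E, Real.exp (-(E * 2)) ∂ν := by
    rw [hf2]
    exact setIntegral_le_integral hI (Filter.Eventually.of_forall fun E => (Real.exp_pos _).le)
  have h2 : ∫ E, Real.exp (-(E * 2)) ∂ν = (∫⁻ E, ENNReal.ofReal (Real.exp (-(E * 2))) ∂ν).toReal :=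
    integral_eq_lintegral_of_nonneg_ae (Filter.Eventually.of_forall fun E => (Real.exp_pos _).le)
      (by fun_prop : Continuous fun E : ℝ => Real.exp (-(E * 2))).aestronglyMeasurable
  rw [laplace_layer_cake ν 2 (by norm_num)] at h2
  -- pointwise bound of the layer-cake integrand
  set K : ENNReal := ENNReal.ofReal (A * (1 + 8 ^ 8)) * ν (Iio 1) with hK
  have hKtop : K ≠ ⊤ := ENNReal.mul_ne_top ENNReal.ofReal_ne_top (measure_ne_top ν _)
  have hpt : ∀ s ∈ Ioi (0:ℝ), ν (Iio (-Real.log s / 2)) ≤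
      (Ioo (0:ℝ) 1).indicator (fun s => K * ENNReal.ofReal (Real.exp (-Real.log s / 2))) s := by
    intro s hs
    have hs0 : (0:ℝ) < s := hs
    by_cases h1s : s < 1
    · rw [indicator_of_mem (show s ∈ Ioo (0:ℝ) 1 from ⟨hs0, h1s⟩)]
      set y := -Real.log s / 2 with hy
      have hlog : Real.log s ≤ 0 := Real.log_nonpos hs0.le h1s.le
      have hy0 : 0 ≤ y := by rw [hy]; linarith
      set lam := max y 1 with hlam
      have hl : 1 ≤ lam := le_max_right _ _
      have hmono : ν (Iio y) ≤ ν (Iio (lam * 1)) :=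
        measure_mono (Iio_subset_Iio (by rw [mul_one]; exact le_max_left _ _))
      have hdb := hd lam 1 hl hE₀1
      have hl8 : lam ^ 8 ≤ (1 + 8 ^ 8) * Real.exp y := by
        have hy8 : y ^ 8 ≤ 8 ^ 8 * Real.exp y := pow_eight_le_exp y hy0
        have he1 : 1 ≤ Real.exp y := Real.one_le_exp hy0
        rcases le_total y 1 with hy1 | hy1
        · rw [show lam = 1 from max_eq_right hy1, one_pow]; nlinarith
        · rw [show lam = y from max_eq_left hy1]; nlinarith
      calc ν (Iio y) ≤ ν (Iio (lam * 1)) := hmono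
        _ ≤ ENNReal.ofReal (A * lam ^ 8) * ν (Iio 1) := hdb
        _ ≤ ENNReal.ofReal (A * ((1 + 8 ^ 8) * Real.exp y)) * ν (Iio 1) := by
            gcongr
        _ = K * ENNReal.ofReal (Real.exp y) := by
            rw [hK, show A * ((1 + 8 ^ 8) * Real.exp y) = (A * (1 + 8 ^ 8)) * Real.exp y by ring,
              ENNReal.ofReal_mul (by positivity)]
            ring
    · push Not at h1s
      have hlog : 0 ≤ Real.log s := Real.log_nonneg h1s
      rw [show ν (Iio (-Real.log s / 2)) = 0 from cum_zero ν hsupp _ (by linarith)]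
      exact bot_le
  -- integrate the pointwise bound
  have h3 : ∫⁻ s in Ioi (0:ℝ), ν (Iio (-Real.log s / 2)) ≤ K * ENNReal.ofReal 2 := by
    calc ∫⁻ s in Ioi (0:ℝ), ν (Iio (-Real.log s / 2))
        ≤ ∫⁻ s in Ioi (0:ℝ), (Ioo (0:ℝ) 1).indicator (fun s => K * ENNReal.ofReal (Real.exp (-Real.log s / 2))) s :=
          setLIntegral_mono' measurableSet_Ioi hpt
      _ = ∫⁻ s in Ioo (0:ℝ) 1, K * ENNReal.ofReal (Real.exp (-Real.log s / 2)) := by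
          rw [lintegral_indicator measurableSet_Ioo, Measure.restrict_restrict measurableSet_Ioo,
            show Ioo (0:ℝ) 1 ∩ Ioi 0 = Ioo 0 1 from inter_eq_left.mpr Ioo_subset_Ioi_self]
      _ = K * ∫⁻ s in Ioo (0:ℝ) 1, ENNReal.ofReal (Real.exp (-Real.log s / 2)) :=
          lintegral_const_mul' K _ hKtop
      _ = K * ENNReal.ofReal 2 := by rw [lintegral_exp_neg_log_half]
  have hK2 : (K * ENNReal.ofReal 2).toReal = A * (1 + 8 ^ 8) * (ν (Iio 1)).toReal * 2 := by
    rw [hK, ENNReal.toReal_mul, ENNReal.toReal_mul, ENNReal.toReal_ofReal (by positivity),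
      ENNReal.toReal_ofReal (by norm_num)]
  calc (∫ E in Ici (1:ℝ), Real.exp (-(2 * E)) ∂ν) ≤ ∫ E, Real.exp (-(E * 2)) ∂ν := h1
    _ = (∫⁻ s in Ioi (0:ℝ), ν (Iio (-Real.log s / 2))).toReal := h2
    _ ≤ (K * ENNReal.ofReal 2).toReal :=
        ENNReal.toReal_mono (ENNReal.mul_ne_top hKtop ENNReal.ofReal_ne_top) h3
    _ = 2 * A * (1 + 8 ^ 8) * (ν (Iio 1)).toReal := by rw [hK2]; ring

end Summit.QuantumFields.YangMills.Cruxes.ScaleMonotonicity.SpectralEdge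

namespace Summit.QuantumFields.YangMills.Theses.ThermodynamicCeilings

open MeasureTheory in
/-- **The edge**: `AntiScreeningCeilings.SubhomogeneousSpectralMeasureR` (27501) implies `WindowedSpectralMeasure` (27776),
with the constant `A ↦ 2A(1+8⁸)`. -/
theorem windowedSpectralMeasure_of_subhomogeneousR :
    Summit.QuantumFields.YangMills.Theses.AntiScreeningCeilings.SubhomogeneousSpectralMeasureR →
      WindowedSpectralMeasure := by
  intro hS G _ _ _ _ hG hiso r v f g h Λ₅
  letI : MeasurableSpace G := borel G
  haveI : BorelSpace G := ⟨rfl⟩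
  obtain ⟨ε₀, hε₀, hmain⟩ := hS G hG hiso r v f g h Λ₅
  refine ⟨ε₀, hε₀, fun ε hε hεε hfl => ?_⟩
  obtain ⟨ℓM, hℓM, hℓ⟩ := hmain ε hε hεε hfl
  refine ⟨ℓM, hℓM, fun ℓ hℓ0 hℓℓ => ?_⟩
  obtain ⟨A, βM, hA, hβ⟩ := hℓ ℓ hℓ0 hℓℓ
  refine ⟨2 * A * (1 + 8 ^ 8), βM, by nlinarith, fun β hββ s hs0 hs1 hwin L q k hq => ?_⟩
  obtain ⟨ν, κ₀, δ, hfin, hsupp, hκ₀, hδ, hrep, hsub⟩ := hβ β hββ s hs0 hs1 hwin L q k hq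
  refine ⟨ν, κ₀, δ, hfin, hsupp, hκ₀, hδ, hrep, ?_, ?_⟩
  · intro lam x hl hx _hlx
    have h1 := hsub lam x hl hx
    have hl0 : 0 ≤ lam ^ 8 := by positivity
    have hm : 0 ≤ (ν (Set.Iio x)).toReal := ENNReal.toReal_nonneg
    have hA2 : A ≤ 2 * A * (1 + 8 ^ 8) := by nlinarith
    calc (ν (Set.Iio (lam * x))).toReal ≤ A * lam ^ 8 * (ν (Set.Iio x)).toReal := h1
      _ ≤ 2 * A * (1 + 8 ^ 8) * lam ^ 8 * (ν (Set.Iio x)).toReal := by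
          have := mul_le_mul_of_nonneg_right (mul_le_mul_of_nonneg_right hA2 hl0) hm
          linarith
  · intro hE₀1
    haveI := hfin
    exact Summit.QuantumFields.YangMills.Cruxes.ScaleMonotonicity.SpectralEdge.uv_of_doubling ν hsupp A _ hA hE₀1 hsub

end Summit.QuantumFields.YangMills.Theses.ThermodynamicCeilings
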